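import Literature.Probability.Percolation.NearCriticalFourArmFacts
import Literature.Probability.Percolation.ArmEventsStructure
import HarnessLib

/-!
# Werner's four-arm estimates below `L(p)` on the sub-critical side, by colour exchange (proofs only)

Topic `Literature/Probability/Percolation`; family `crit-perc`, statement **crit-perc.S16**
(`Literature.Probability.Percolation.triTheta_exponent`). Proofs only (no new definition, no new
named fact). The tree records the three four-arm inputs of Kesten's near-critical theory in
W. Werner's conventions (*Lectures on two-dimensional critical percolation*, PCMI 2009, Lecture 6),
for parameters `t` in a RIGHT neighbourhood `[1/2, 1/2 + δ)` of `1/2` and radii below Werner's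
length `L(t, ε) = charLengthW ε t`:

* `Werner2009_fourArm_quasiMult` (Cor. 6.2, `NearCriticalFourArmFacts.lean`),
* `Werner2009_fourArm_lowerBound` (§3, third a priori estimate, ibid.),
* `Werner2009_lemma63` (Lemma 6.3, four-arm stability below `L`, `WernerPivotalEstimates.lean`).

Nolin's versions (*Electron. J. Probab.* 13 (2008), Prop. 17, Thm. 27 [arXiv 0711.4948: Prop. 16,
Thm. 26]) are stated "uniformly in `P̂` between `P_p` and `P_{1-p}`", i.e. on BOTH sides of `1/2`.
For the tree's four-arm probability `π̂_t(r, R) = fourArmProbAt t r R = P_t(armEvent ![T,F,T,F] r R)`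
the two sides are exchanged by the colour symmetry `ω ↦ ωᶜ`, which maps `P_t` to `P_{1-t}`
(`sitePercolation_real_preimage_compl`) and the alternating pattern `TFTF` to `FTFT`, a cyclic
relabelling of the SAME event (the tree's `armEvent` quantifies over arms indexed by `Fin k` with a
colour for each index and no cyclic order, so it is invariant under permutations of the indices:
`armEvent_comp_equiv`). Hence `π̂_{1-t}(r, R) = π̂_t(r, R)` (`fourArmProbAt_symm`), and since also
`L(1 - t, ε) = L(t, ε)` (`charLengthW_symm`) and `π₄ = π̂_{1/2}` is unchanged, each of the three facts
implies its two-sided form `|t - 1/2| < δ` (`Werner2009_fourArm_quasiMult.two_sided`,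
`Werner2009_fourArm_lowerBound.two_sided`, `Werner2009_lemma63.two_sided`), with Nolin's length as
well (`charLength ε t ≤ charLengthW ε t`, `charLength_le_charLengthW`, is recorded in
`WernerCorrelationLengthProofs.lean` and not repeated here). These are the four-arm inputs of the
sub-critical half of Nolin's Thm. 27 for one arm (`oneArm_sub_of_pivotal_bound`,
`NearCriticalScalingOneArmProofs.lean`).

## References

* W. Werner, *Lectures on two-dimensional critical percolation*, IAS/Park City Math. Ser. 16
  (2009), Lecture 6, §3, Cor. 6.2, Lemma 6.3 [WernerPCMI2009].
* P. Nolin, Near-critical percolation in two dimensions, *Electron. J. Probab.* 13 (2008), §2.1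
  (`P̂` between `P_p` and `P_{1-p}`), Prop. 17, Thm. 27 [arXiv 0711.4948: Prop. 16, Thm. 26] [Nolin2008].
* S. Smirnov, W. Werner, *Math. Res. Lett.* 8 (2001), Rem. 2 ("Changing the colors") [SmirnovWernerMRL2001].

Tree: `armEvent`, `IsColouredPath` (`ArmEvents.lean`), `compl_preimage_armEvent`
(`ArmEventsStructure.lean`), `sitePercolation_real_preimage_compl` (`TriHexLemma.lean`),
`fourArmProbAt` (`WernerPivotalEstimates.lean`), `charLengthW_symm` (`WernerCorrelationLength.lean`).
Mathlib: `finRotate`, `Equiv`.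
-/

noncomputable section

open MeasureTheory Set
open scoped unitInterval

namespace Literature.Probability.Percolation

open LatticeModels

/-! ### Arm events do not depend on the labelling of the arms -/

/-- Relabelling the arms along a bijection of the index set: `armEvent (κ ∘ e) r R ⊆ armEvent κ r R`.
[folklore] -/
theorem armEvent_comp_equiv_subset {k : ℕ} (κ : Fin k → Bool) (e : Fin k ≃ Fin k) (r R : ℕ) :
    armEvent (κ ∘ e) r R ⊆ armEvent κ r R := by
  rintro ω ⟨x, y, w, hw, hdisj⟩
  refine ⟨fun j => x (e.symm j), fun j => y (e.symm j), fun j => w (e.symm j), fun j => ?_, ?_⟩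
  · obtain ⟨h1, h2, h3, h4, h5⟩ := hw (e.symm j)
    refine ⟨h1, h2, h3, h4, ?_⟩
    simpa only [Function.comp_apply, Equiv.apply_symm_apply] using h5
  · intro i j hij
    exact hdisj (fun h => hij (e.symm.injective h))

/-- **Arm events are invariant under relabelling of the arms**: `armEvent (κ ∘ e) r R = armEvent κ r R`
for every bijection `e` of `Fin k` (the tree's `armEvent` imposes no cyclic order). [folklore] -/
theorem armEvent_comp_equiv {k : ℕ} (κ : Fin k → Bool) (e : Fin k ≃ Fin k) (r R : ℕ) :
    armEvent (κ ∘ e) r R = armEvent κ r R := by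
  refine Subset.antisymm (armEvent_comp_equiv_subset κ e r R) ?_
  have h := armEvent_comp_equiv_subset (κ ∘ e) e.symm r R
  have hκ : (κ ∘ e) ∘ e.symm = κ := by
    funext j; simp only [Function.comp_apply, Equiv.apply_symm_apply]
  rwa [hκ] at h

/-! ### Colour exchange -/

/-- **Colour exchange**: `P_{1-t}(armEvent κ r R) = P_t(armEvent (¬κ) r R)` (the map `ω ↦ ωᶜ` sends
`P_t` to `P_{1-t}` and flips all colours; Smirnov–Werner 2001, Rem. 2; Nolin 2008, §2.1). [cite: SmirnovWernerMRL2001, Rem. 2] -/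
theorem real_armEvent_symm {k : ℕ} (t : unitInterval) (κ : Fin k → Bool) (r R : ℕ) :
    (triSitePercolation (σ t)).real (armEvent κ r R) =
      (triSitePercolation t).real (armEvent (fun j => !κ j) r R) := by
  rw [← compl_preimage_armEvent, triSitePercolation, triSitePercolation,
    sitePercolation_real_preimage_compl]

/-- The flipped alternating pattern is the alternating pattern rotated by one step. [folklore] -/
theorem not_alternating_eq_comp_finRotate :
    (fun j => !(![true, false, true, false] : Fin 4 → Bool) j) =
      (![true, false, true, false] : Fin 4 → Bool) ∘ finRotate 4 := by
  funext j
  fin_cases j <;> rfl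

/-- **`π̂_{1-t}(r, R) = π̂_t(r, R)`**: the tree's four-arm probability is symmetric about `t = 1/2`
(colour exchange turns `TFTF` into `FTFT`, the same event up to relabelling the arms). This is why
Werner's estimates for `p ≥ 1/2` serve Nolin's two-sided statements. [cite: Nolin2008, §2.1 (P̂ between P_p and P_{1-p})] [cite: SmirnovWernerMRL2001, Rem. 2] -/
theorem fourArmProbAt_symm (t : unitInterval) (r R : ℕ) :
    fourArmProbAt (σ t) r R = fourArmProbAt t r R := by
  rw [fourArmProbAt, fourArmProbAt, real_armEvent_symm, not_alternating_eq_comp_finRotate,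
    armEvent_comp_equiv]

/-- For `t < 1/2` near `1/2`, the dual parameter `1 - t` lies in `(1/2, 1/2 + δ)`. [folklore] -/
theorem symm_mem_of_lt_half {t : unitInterval} {δ : ℝ} (ht : (t : ℝ) < 1 / 2)
    (hδ : 1 / 2 - δ < (t : ℝ)) :
    1 / 2 < ((σ t : unitInterval) : ℝ) ∧ ((σ t : unitInterval) : ℝ) < 1 / 2 + δ := by
  rw [unitInterval.coe_symm_eq]; constructor <;> linarith

/-! ### The three facts on both sides of `1/2` -/

/-- **Quasi-multiplicativity of four arms below `L`, both sides of `1/2`** (Werner 2009, Cor. 6.2;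
Nolin 2008, Prop. 17 [arXiv: Prop. 16], "uniformly in `P̂` between `P_p` and `P_{1-p}`"): the
tree's `Werner2009_fourArm_quasiMult` (stated for `t ∈ [1/2, 1/2 + δ)`) implies the same bound for
`|t - 1/2| < δ`, with `S ≤ L(t, ε)` required for `t ≠ 1/2` (`fourArmProbAt_symm`, `charLengthW_symm`). [cite: WernerPCMI2009, Lecture 6, Cor. 6.2] [cite: Nolin2008, §4.5, Prop. 17 (arXiv 0711.4948: Prop. 16)] -/
theorem Werner2009_fourArm_quasiMult.two_sided (h : Werner2009_fourArm_quasiMult) :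
    ∃ ε₁ > (0 : ℝ), ∀ ⦃ε : ℝ⦄, 0 < ε → ε < ε₁ →
      ∃ r₁ : ℕ, ∃ δ > (0 : ℝ), ∃ c > (0 : ℝ),
        ∀ t : unitInterval, |(t : ℝ) - 1 / 2| < δ →
          ∀ r R S : ℕ, r₁ ≤ r → 16 * r < 4 * R → 4 * R < S →
            ((t : ℝ) ≠ 1 / 2 → S ≤ charLengthW ε t) →
              c * (fourArmProbAt t r R * fourArmProbAt t (4 * R) S) ≤ fourArmProbAt t r S := by
  obtain ⟨ε₁, hε₁, h⟩ := h
  refine ⟨ε₁, hε₁, fun ε hε hεlt => ?_⟩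
  obtain ⟨r₁, δ, hδ, c, hc, hb⟩ := h hε hεlt
  refine ⟨r₁, δ, hδ, c, hc, fun t ht r R S hr hR hS hSL => ?_⟩
  rw [abs_sub_lt_iff] at ht
  rcases lt_or_ge (t : ℝ) (1 / 2) with hlt | hge
  · obtain ⟨h1, h2⟩ := symm_mem_of_lt_half (δ := δ) hlt (by linarith)
    have hb' := hb (σ t) h1.le h2 r R S hr hR hS fun _ => by
      rw [charLengthW_symm]; exact hSL hlt.ne
    simpa only [fourArmProbAt_symm] using hb'
  · exact hb t hge (by linarith) r R S hr hR hS fun h' => hSL h'.ne'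

/-- **A priori lower bound for four arms below `L`, both sides of `1/2`** (Werner 2009, Lecture 6,
§3; Nolin 2008, Thm. 24 / (4.15) with Thm. 27): the tree's `Werner2009_fourArm_lowerBound` implies
`c (m/n)^{2-β} ≤ π̂_t(m, n)` for `|t - 1/2| < δ`, `r₁ ≤ m ≤ n`, `n ≤ L(t, ε)` for `t ≠ 1/2`. [cite: WernerPCMI2009, Lecture 6, §3 (third a priori estimate)] -/
theorem Werner2009_fourArm_lowerBound.two_sided (h : Werner2009_fourArm_lowerBound) :
    ∃ ε₁ > (0 : ℝ), ∀ ⦃ε : ℝ⦄, 0 < ε → ε < ε₁ →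
      ∃ r₁ : ℕ, ∃ δ > (0 : ℝ), ∃ β > (0 : ℝ), ∃ c > (0 : ℝ),
        ∀ t : unitInterval, |(t : ℝ) - 1 / 2| < δ →
          ∀ m n : ℕ, r₁ ≤ m → m ≤ n → ((t : ℝ) ≠ 1 / 2 → n ≤ charLengthW ε t) →
            c * ((m : ℝ) / n) ^ (2 - β) ≤ fourArmProbAt t m n := by
  obtain ⟨ε₁, hε₁, h⟩ := h
  refine ⟨ε₁, hε₁, fun ε hε hεlt => ?_⟩
  obtain ⟨r₁, δ, hδ, β, hβ, c, hc, hb⟩ := h hε hεlt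
  refine ⟨r₁, δ, hδ, β, hβ, c, hc, fun t ht m n hm hmn hnL => ?_⟩
  rw [abs_sub_lt_iff] at ht
  rcases lt_or_ge (t : ℝ) (1 / 2) with hlt | hge
  · obtain ⟨h1, h2⟩ := symm_mem_of_lt_half (δ := δ) hlt (by linarith)
    have hb' := hb (σ t) h1.le h2 m n hm hmn fun _ => by
      rw [charLengthW_symm]; exact hnL hlt.ne
    simpa only [fourArmProbAt_symm] using hb'
  · exact hb t hge (by linarith) m n hm hmn fun h' => hnL h'.ne'

/-- **Four-arm stability below `L`, both sides of `1/2`** (Werner 2009, Lemma 6.3; Nolin 2008,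
Thm. 27 [arXiv: Thm. 26], `j = 4`, "uniformly in `P̂` between `P_p` and `P_{1-p}`"): the tree's
`Werner2009_lemma63` implies `c π₄(N) ≤ π̂_t(r₀, N) ≤ C π₄(N)` for `|t - 1/2| < δ`, `n₁ ≤ N`,
`N ≤ L(t, ε)` for `t ≠ 1/2` (`π₄ = critFourArmProb r₀ = π̂_{1/2}` is unchanged by the symmetry). [cite: WernerPCMI2009, Lecture 6, Lemma 6.3] [cite: Nolin2008, §6.1, Thm. 27 (arXiv 0711.4948: Thm. 26), j = 4] -/
theorem Werner2009_lemma63.two_sided (h : Werner2009_lemma63) :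
    ∃ ε₁ > (0 : ℝ), ∀ ⦃ε : ℝ⦄, 0 < ε → ε < ε₁ →
      ∃ r₁ : ℕ, ∀ r₀ ≥ r₁, ∃ n₁ : ℕ, ∃ δ > (0 : ℝ), ∃ c > (0 : ℝ), ∃ C : ℝ,
        ∀ t : unitInterval, |(t : ℝ) - 1 / 2| < δ →
          ∀ N : ℕ, n₁ ≤ N → ((t : ℝ) ≠ 1 / 2 → N ≤ charLengthW ε t) →
            c * critFourArmProb r₀ N ≤ fourArmProbAt t r₀ N ∧
              fourArmProbAt t r₀ N ≤ C * critFourArmProb r₀ N := by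
  obtain ⟨ε₁, hε₁, h⟩ := h
  refine ⟨ε₁, hε₁, fun ε hε hεlt => ?_⟩
  obtain ⟨r₁, hr₁⟩ := h hε hεlt
  refine ⟨r₁, fun r₀ hr₀ => ?_⟩
  obtain ⟨n₁, δ, hδ, c, hc, C, hb⟩ := hr₁ r₀ hr₀
  refine ⟨n₁, δ, hδ, c, hc, C, fun t ht N hN hNL => ?_⟩
  rw [abs_sub_lt_iff] at ht
  rcases lt_or_ge (t : ℝ) (1 / 2) with hlt | hge
  · obtain ⟨h1, h2⟩ := symm_mem_of_lt_half (δ := δ) hlt (by linarith)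
    have hb' := hb (σ t) h1.le h2 N hN fun _ => by
      rw [charLengthW_symm]; exact hNL hlt.ne
    simpa only [fourArmProbAt_symm] using hb'
  · exact hb t hge (by linarith) N hN fun h' => hNL h'.ne'

end Literature.Probability.Percolation
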